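import Summits.CriticalPhenomena.PercolationContinuityZ3.Theorems.PercNearOneGluingNoHeavyLowerTailSunflowerLeafLeafFreeMoves
import HarnessLib

/-!
# `NoHeavyLowerTail` (crux stmt-CriticalPhenomena-4575), abstract sunflower cubic: `FreeFour` — the EXCHANGE REDUCTION to families
# with at most one free row resource and at most one free column resource strictly between link and cap (`FreeFourCore`)

Support file (seat `prim-ineq-prove-1` gen 67; `--supports stmt-CriticalPhenomena-4575`).  No `sorry`, no named facts; one definition
(`FreeFourCore`, the residual statement, conjecture-shaped) used only as a hypothesis.  Memo: run/shared/lean/prim/prim-ineq-prove-1/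
FINDING-FREEFOUR-prove1-g67.md §4.2.

`FreeFour σ s τ t α` (`…SunflowerLeafLeafFree`) ⇔ the leaf-leaf lemma.  Its left side is, in each free resource separately, a product
`∏_j (K_j + P·y_j)` with `K_j, P ≥ 0`, the `y_j` being constrained only by their links `ℓ_j ≤ y_j`, the cap `y_j ≤ 1` and ONE product
budget `∏ y_j ≤ B`.  The exchange `y_i ↦ θy_i`, `y_j ↦ y_j/θ` keeps all of this and the product is `p + qθ + r/θ`
(`prod_exchange_le_max`), so it is maximal when one of the two moved resources is at its link or at the cap:
* **`prod_le_of_atMostOneInterior`** — the abstract statement: if `∏ (K_j + P y_j) ≤ M` for every admissible `y` with AT MOST ONE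
  index strictly between link and cap, then it holds for every admissible `y` (induction on the number of interior indices);
* `FreeFourCore σ s τ t α` — `FreeFour` restricted to families with at most one interior `y` and at most one interior `x`;
* **`freeFour_of_freeFourCore`** — `FreeFourCore ⇒ FreeFour` (floors `0 < α₀₀`, coins in `[0,1]`).
With `freeFour_of_xLink` / `freeFour_of_yLink` (no interior and no capped resource on one side) and the capped cases (`y = 1` or
`x = 1`: `…SunflowerLeafLeafZTwo`, memo §4.3) the content of `FreeFourCore` is the two endgames of memo §5 (one `x`-slack petal and
one `y`-slack petal, or one petal with both slacks, among base petals).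
-/

noncomputable section

namespace Summit.CriticalPhenomena.PercolationContinuityZ3.Theorems.SunflowerPartition

namespace SafeCalc

namespace LeafLeafZ

open Finset LinkedCurrency

/-- "At most one free resource is strictly between its link and the cap `1`." [this work] -/
def AtMostOneInterior {n : ℕ} (ℓ y : Fin n → ℝ) : Prop :=
  ∀ i j, ℓ i < y i → y i < 1 → ℓ j < y j → y j < 1 → i = j

/-- **The exchange reduction, abstract form.**  `K_j ≥ 0`, `P ≥ 0`, links `0 < ℓ_j`.  If `∏ (K_j + P y_j) ≤ M` for every
`y` with `ℓ ≤ y ≤ 1`, `∏ y ≤ B` and at most one interior index, then the same holds for every `y` with `ℓ ≤ y ≤ 1`, `∏ y ≤ B`.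
[this work] -/
theorem prod_le_of_atMostOneInterior {n : ℕ} {K ℓ : Fin n → ℝ} {P B M : ℝ} (hK : ∀ j, 0 ≤ K j) (hP : 0 ≤ P)
    (hℓ0 : ∀ j, 0 < ℓ j)
    (hcore : ∀ y : Fin n → ℝ, (∀ j, ℓ j ≤ y j) → (∀ j, y j ≤ 1) → ∏ j, y j ≤ B → AtMostOneInterior ℓ y →
      ∏ j, (K j + P * y j) ≤ M)
    (y : Fin n → ℝ) (hy : ∀ j, ℓ j ≤ y j) (hy1 : ∀ j, y j ≤ 1) (hB : ∏ j, y j ≤ B) :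
    ∏ j, (K j + P * y j) ≤ M := by
  classical
  -- induction on the number of interior indices
  suffices H : ∀ (m : ℕ) (y : Fin n → ℝ), (univ.filter fun j => ℓ j < y j ∧ y j < 1).card ≤ m → (∀ j, ℓ j ≤ y j) →
      (∀ j, y j ≤ 1) → ∏ j, y j ≤ B → ∏ j, (K j + P * y j) ≤ M from H _ y le_rfl hy hy1 hB
  intro m
  induction m with
  | zero =>
    intro y hc hy hy1 hB
    refine hcore y hy hy1 hB fun i j hi hi1 hj hj1 => ?_
    have : i ∈ univ.filter fun j => ℓ j < y j ∧ y j < 1 := by simp [hi, hi1]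
    rw [Nat.le_zero, card_eq_zero] at hc
    rw [hc] at this; simp at this
  | succ m ih =>
    intro y hc hy hy1 hB
    by_cases hone : AtMostOneInterior ℓ y
    · exact hcore y hy hy1 hB hone
    -- two distinct interior indices `i ≠ j`
    obtain ⟨i, j, hi, hi1, hj, hj1, hij⟩ : ∃ i j, ℓ i < y i ∧ y i < 1 ∧ ℓ j < y j ∧ y j < 1 ∧ i ≠ j := by
      simp only [AtMostOneInterior, not_forall] at hone
      obtain ⟨i, j, hi, hi1, hj, hj1, hij⟩ := hone
      exact ⟨i, j, hi, hi1, hj, hj1, hij⟩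
    have hyi0 : 0 < y i := (hℓ0 i).trans hi
    have hyj0 : 0 < y j := (hℓ0 j).trans hj
    -- the exchange endpoints
    set tlo : ℝ := max (ℓ i / y i) (y j) with htlo
    set thi : ℝ := min (1 / y i) (y j / ℓ j) with hthi
    have hlo0 : 0 < tlo := lt_of_lt_of_le hyj0 (le_max_right _ _)
    have hlo1 : tlo ≤ 1 := max_le ((div_le_one hyi0).2 hi.le) hj1.le
    have hhi1 : 1 ≤ thi := le_min (by rw [le_div_iff₀ hyi0, one_mul]; exact hi1.le)
      (by rw [le_div_iff₀ (hℓ0 j), one_mul]; exact hj.le)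
    have hhi0 : 0 < thi := zero_lt_one.trans_le hhi1
    -- the moved family
    let mv : ℝ → Fin n → ℝ := fun θ => Function.update (Function.update y i (y i * θ)) j (y j / θ)
    have mv_i : ∀ θ, mv θ i = y i * θ := fun θ => by
      simp only [mv]; rw [Function.update_of_ne hij, Function.update_self]
    have mv_j : ∀ θ, mv θ j = y j / θ := fun θ => by simp only [mv]; rw [Function.update_self]
    have mv_k : ∀ θ k, k ≠ i → k ≠ j → mv θ k = y k := fun θ k hki hkj => by
      simp only [mv]; rw [Function.update_of_ne hkj, Function.update_of_ne hki]
    -- products split off the two moved factors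
    have hjmem : j ∈ univ.erase i := mem_erase.2 ⟨hij.symm, mem_univ j⟩
    have split : ∀ (F : Fin n → ℝ), ∏ k, F k = F i * (F j * ∏ k ∈ (univ.erase i).erase j, F k) := fun F => by
      rw [← mul_prod_erase univ F (mem_univ i), ← mul_prod_erase _ F hjmem]
    have rest_eq : ∀ θ, ∏ k ∈ (univ.erase i).erase j, (K k + P * mv θ k) = ∏ k ∈ (univ.erase i).erase j, (K k + P * y k) := by
      intro θ
      refine prod_congr rfl fun k hk => ?_
      have hkj : k ≠ j := (mem_erase.1 hk).1
      have hki : k ≠ i := (mem_erase.1 (mem_erase.1 hk).2).1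
      rw [mv_k θ k hki hkj]
    have rest_eq' : ∀ θ, ∏ k ∈ (univ.erase i).erase j, mv θ k = ∏ k ∈ (univ.erase i).erase j, y k := by
      intro θ
      refine prod_congr rfl fun k hk => ?_
      have hkj : k ≠ j := (mem_erase.1 hk).1
      have hki : k ≠ i := (mem_erase.1 (mem_erase.1 hk).2).1
      rw [mv_k θ k hki hkj]
    have hR : 0 ≤ ∏ k ∈ (univ.erase i).erase j, (K k + P * y k) :=
      prod_nonneg fun k _ => add_nonneg (hK k) (mul_nonneg hP ((hℓ0 k).le.trans (hy k)))
    -- budget preserved, links and caps at the endpoints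
    have budget : ∀ θ, θ ≠ 0 → ∏ k, mv θ k = ∏ k, y k := fun θ hθ => by
      rw [split (mv θ), split y, rest_eq' θ, mv_i, mv_j]
      field_simp
    have links : ∀ θ, tlo ≤ θ → θ ≤ thi → ∀ k, ℓ k ≤ mv θ k := by
      intro θ h1 h2 k
      by_cases hki : k = i
      · subst hki; rw [mv_i]
        have : ℓ k / y k ≤ θ := (le_max_left _ _).trans h1
        rwa [div_le_iff₀ hyi0, mul_comm] at this
      by_cases hkj : k = j
      · subst hkj; rw [mv_j, le_div_iff₀ (hlo0.trans_le h1)]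
        have : θ ≤ y k / ℓ k := h2.trans (min_le_right _ _)
        rw [le_div_iff₀ (hℓ0 k)] at this
        linarith
      · rw [mv_k θ k hki hkj]; exact hy k
    have caps : ∀ θ, tlo ≤ θ → θ ≤ thi → ∀ k, mv θ k ≤ 1 := by
      intro θ h1 h2 k
      by_cases hki : k = i
      · subst hki; rw [mv_i]
        have : θ ≤ 1 / y k := h2.trans (min_le_left _ _)
        rw [le_div_iff₀ hyi0, mul_comm] at this
        exact this
      by_cases hkj : k = j
      · subst hkj; rw [mv_j, div_le_one (hlo0.trans_le h1)]
        exact (le_max_right _ _).trans h1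
      · rw [mv_k θ k hki hkj]; exact hy1 k
    -- the interior count drops at each endpoint
    have count_lt : ∀ θ, (θ = tlo ∨ θ = thi) →
        (univ.filter fun k => ℓ k < mv θ k ∧ mv θ k < 1).card ≤ m := by
      intro θ hθ
      have hsub : (univ.filter fun k => ℓ k < mv θ k ∧ mv θ k < 1) ⊆ univ.filter fun k => ℓ k < y k ∧ y k < 1 := by
        intro k hk
        simp only [mem_filter, mem_univ, true_and] at hk ⊢
        by_cases hki : k = i
        · subst hki; exact ⟨hi, hi1⟩
        by_cases hkj : k = j
        · subst hkj; exact ⟨hj, hj1⟩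
        rw [mv_k θ k hki hkj] at hk; exact hk
      -- one of `i`, `j` is no longer interior
      have hdrop : ∃ k, (ℓ k < y k ∧ y k < 1) ∧ ¬ (ℓ k < mv θ k ∧ mv θ k < 1) := by
        rcases hθ with rfl | rfl
        · rcases max_choice (ℓ i / y i) (y j) with h | h
          · refine ⟨i, ⟨hi, hi1⟩, ?_⟩
            rw [mv_i, htlo, h, mul_div_cancel₀ _ hyi0.ne']; exact fun hh => lt_irrefl _ hh.1
          · refine ⟨j, ⟨hj, hj1⟩, ?_⟩
            rw [mv_j, htlo, h, div_self hyj0.ne']; exact fun hh => lt_irrefl _ hh.2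
        · rcases min_choice (1 / y i) (y j / ℓ j) with h | h
          · refine ⟨i, ⟨hi, hi1⟩, ?_⟩
            rw [mv_i, hthi, h, mul_one_div_cancel hyi0.ne']; exact fun hh => lt_irrefl _ hh.2
          · refine ⟨j, ⟨hj, hj1⟩, ?_⟩
            rw [mv_j, hthi, h, div_div_cancel₀ hyj0.ne']; exact fun hh => lt_irrefl _ hh.1
      obtain ⟨k, hk1, hk2⟩ := hdrop
      have hssub : (univ.filter fun k => ℓ k < mv θ k ∧ mv θ k < 1) ⊂ univ.filter fun k => ℓ k < y k ∧ y k < 1 := by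
        refine ⟨hsub, fun hsup => hk2 ?_⟩
        have : k ∈ univ.filter fun k => ℓ k < y k ∧ y k < 1 := by simp [hk1]
        have := hsup this
        simpa using this
      have := card_lt_card hssub
      omega
    -- the value comparison
    have hval : ∏ k, (K k + P * y k) ≤
        max (∏ k, (K k + P * mv tlo k)) (∏ k, (K k + P * mv thi k)) := by
      rw [split (fun k => K k + P * y k), split (fun k => K k + P * mv tlo k), split (fun k => K k + P * mv thi k),
        rest_eq tlo, rest_eq thi, mv_i, mv_j, mv_i, mv_j]
      set R := ∏ k ∈ (univ.erase i).erase j, (K k + P * y k) with hRdef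
      have hx := prod_exchange_le_max (Kj := K j) (yi := y i) (hK i) hP ((hℓ0 j).le.trans (hy j)) hlo0 hlo1 hhi1
      have h2 := mul_le_mul_of_nonneg_right hx hR
      rw [max_mul_of_nonneg _ _ hR] at h2
      calc (K i + P * y i) * ((K j + P * y j) * R) = (K i + P * y i) * (K j + P * y j) * R := by ring
        _ ≤ max ((K i + P * (y i * tlo)) * (K j + P * (y j / tlo)) * R) ((K i + P * (y i * thi)) * (K j + P * (y j / thi)) * R) := h2
        _ = _ := by rw [mul_assoc, mul_assoc]
    refine hval.trans (max_le ?_ ?_)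
    · exact ih (mv tlo) (count_lt tlo (Or.inl rfl)) (links tlo le_rfl (hlo1.trans hhi1)) (caps tlo le_rfl (hlo1.trans hhi1))
        (by rw [budget tlo hlo0.ne']; exact hB)
    · exact ih (mv thi) (count_lt thi (Or.inr rfl)) (links thi (hlo1.trans hhi1) le_rfl) (caps thi (hlo1.trans hhi1) le_rfl)
        (by rw [budget thi hhi0.ne']; exact hB)

/-- **`FreeFourCore` (statement)**: `FreeFour` restricted to families with at most one row resource `y_j` strictly between its link
`(1−s)e_j+sg_j` and `1`, and at most one column resource `x_j` strictly between `(1−σ)e_j+σf_j` and `1`.  Open; equivalent to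
`FreeFour` (`freeFour_of_freeFourCore`); its content is the two endgames of memo §5. [conjecture-shaped hypothesis, this work] -/
def FreeFourCore (σ s τ t α00 α01 α10 α11 : ℝ) : Prop :=
  ∀ (n : ℕ) (e g f h y x : Fin n → ℝ),
    (∀ j, α00 ≤ e j) → (∀ j, α01 ≤ g j) → (∀ j, α10 ≤ f j) → (∀ j, α11 ≤ h j) → (∀ j, h j ≤ 1) →
    (∀ j, e j ≤ g j) → (∀ j, e j ≤ f j) → (∀ j, g j ≤ h j) → (∀ j, f j ≤ h j) →
    (∀ j, (1 - s) * e j + s * g j ≤ y j) → (∀ j, y j ≤ 1) → (∀ j, (1 - σ) * e j + σ * f j ≤ x j) → (∀ j, x j ≤ 1) →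
    ∏ j, e j ≤ α00 ^ (n - 1) → ∏ j, g j ≤ α01 ^ (n - 1) → ∏ j, f j ≤ α10 ^ (n - 1) → ∏ j, h j ≤ α11 ^ (n - 1) →
    ∏ j, ((1 - s) * e j + s * g j) ≤ ((1 - s) * α00 + s * α01) ^ (n - 1) →
    ∏ j, ((1 - s) * f j + s * h j) ≤ ((1 - s) * α10 + s * α11) ^ (n - 1) →
    ∏ j, ((1 - σ) * e j + σ * f j) ≤ ((1 - σ) * α00 + σ * α10) ^ (n - 1) →
    ∏ j, ((1 - σ) * g j + σ * h j) ≤ ((1 - σ) * α01 + σ * α11) ^ (n - 1) →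
    ∏ j, ((1 - σ) * ((1 - s) * e j + s * g j) + σ * ((1 - s) * f j + s * h j)) ≤
      ((1 - σ) * ((1 - s) * α00 + s * α01) + σ * ((1 - s) * α10 + s * α11)) ^ (n - 1) →
    ∏ j, y j ≤ ((1 - s) * α00 + s * α01) ^ (n - 1) →
    ∏ j, x j ≤ ((1 - σ) * α00 + σ * α10) ^ (n - 1) →
    AtMostOneInterior (fun j => (1 - s) * e j + s * g j) y →
    AtMostOneInterior (fun j => (1 - σ) * e j + σ * f j) x →
    ∏ j, (τ * t + τ * (1 - t) * σ + (1 - τ) * t * s + τ * (1 - t) * (1 - σ) * y j + (1 - τ) * t * (1 - s) * x j +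
        (1 - τ) * (1 - t) * ((1 - σ) * ((1 - s) * e j + s * g j) + σ * ((1 - s) * f j + s * h j))) ≤
      (τ * t + τ * (1 - t) * σ + (1 - τ) * t * s + τ * (1 - t) * (1 - σ) * ((1 - s) * α00 + s * α01) +
        (1 - τ) * t * (1 - s) * ((1 - σ) * α00 + σ * α10) +
        (1 - τ) * (1 - t) * ((1 - σ) * ((1 - s) * α00 + s * α01) + σ * ((1 - s) * α10 + s * α11))) ^ (n - 1)

/-- **`FreeFourCore ⇒ FreeFour`**: the exchange reduction applied to the row resources and then to the column resources
(coins in `[0,1]`, floor `0 < α₀₀`). [this work] -/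
theorem freeFour_of_freeFourCore {σ s τ t α00 α01 α10 α11 : ℝ} (hσ0 : 0 ≤ σ) (hσ1 : σ ≤ 1) (hs0 : 0 ≤ s) (hs1 : s ≤ 1)
    (hτ0 : 0 ≤ τ) (hτ1 : τ ≤ 1) (ht0 : 0 ≤ t) (ht1 : t ≤ 1) (hα : 0 < α00)
    (hC : FreeFourCore σ s τ t α00 α01 α10 α11) : FreeFour σ s τ t α00 α01 α10 α11 := by
  intro n e g f h y x he hg hf hh hh1 leg lef lgh lfh ly hy1 lx hx1 Be Bg Bf Bh Br0 Br1 Bc0 Bc1 BA By Bx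
  have hσ' : 0 ≤ 1 - σ := sub_nonneg.2 hσ1
  have hs' : 0 ≤ 1 - s := sub_nonneg.2 hs1
  have hτ' : 0 ≤ 1 - τ := sub_nonneg.2 hτ1
  have ht' : 0 ≤ 1 - t := sub_nonneg.2 ht1
  -- positivity of the links and of the fixed parts of the factors
  have he0 : ∀ j, 0 ≤ e j := fun j => hα.le.trans (he j)
  have hg0 : ∀ j, 0 ≤ g j := fun j => (he0 j).trans (leg j)
  have hf0 : ∀ j, 0 ≤ f j := fun j => (he0 j).trans (lef j)
  have hh0 : ∀ j, 0 ≤ h j := fun j => (hf0 j).trans (lfh j)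
  have hr0 : ∀ j, 0 < (1 - s) * e j + s * g j := fun j => by
    have k1 := mul_nonneg hs0 (sub_nonneg.2 (leg j))
    have e1 : (1 - s) * e j + s * g j = e j + s * (g j - e j) := by ring
    rw [e1]; exact lt_of_lt_of_le (hα.trans_le (he j)) (le_add_of_nonneg_right k1)
  have hc0 : ∀ j, 0 < (1 - σ) * e j + σ * f j := fun j => by
    have k1 := mul_nonneg hσ0 (sub_nonneg.2 (lef j))
    have e1 : (1 - σ) * e j + σ * f j = e j + σ * (f j - e j) := by ring
    rw [e1]; exact lt_of_lt_of_le (hα.trans_le (he j)) (le_add_of_nonneg_right k1)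
  have hblk : ∀ j, 0 ≤ (1 - σ) * ((1 - s) * e j + s * g j) + σ * ((1 - s) * f j + s * h j) := fun j =>
    add_nonneg (mul_nonneg hσ' (hr0 j).le)
      (mul_nonneg hσ0 (add_nonneg (mul_nonneg hs' (hf0 j)) (mul_nonneg hs0 (hh0 j))))
  have hκ : 0 ≤ τ * t + τ * (1 - t) * σ + (1 - τ) * t * s :=
    add_nonneg (add_nonneg (mul_nonneg hτ0 ht0) (mul_nonneg (mul_nonneg hτ0 ht') hσ0)) (mul_nonneg (mul_nonneg hτ' ht0) hs0)
  have hP : 0 ≤ τ * (1 - t) * (1 - σ) := mul_nonneg (mul_nonneg hτ0 ht') hσ'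
  have hR : 0 ≤ (1 - τ) * t * (1 - s) := mul_nonneg (mul_nonneg hτ' ht0) hs'
  have hQ : 0 ≤ (1 - τ) * (1 - t) := mul_nonneg hτ' ht'
  set M : ℝ := (τ * t + τ * (1 - t) * σ + (1 - τ) * t * s + τ * (1 - t) * (1 - σ) * ((1 - s) * α00 + s * α01) +
        (1 - τ) * t * (1 - s) * ((1 - σ) * α00 + σ * α10) +
        (1 - τ) * (1 - t) * ((1 - σ) * ((1 - s) * α00 + s * α01) + σ * ((1 - s) * α10 + s * α11))) ^ (n - 1) with hM
  -- reduce the row resources, and inside it the column resources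
  have step : ∀ y' : Fin n → ℝ, (∀ j, (1 - s) * e j + s * g j ≤ y' j) → (∀ j, y' j ≤ 1) →
      ∏ j, y' j ≤ ((1 - s) * α00 + s * α01) ^ (n - 1) → AtMostOneInterior (fun j => (1 - s) * e j + s * g j) y' →
      ∏ j, ((τ * t + τ * (1 - t) * σ + (1 - τ) * t * s + (1 - τ) * t * (1 - s) * x j +
        (1 - τ) * (1 - t) * ((1 - σ) * ((1 - s) * e j + s * g j) + σ * ((1 - s) * f j + s * h j))) +
        τ * (1 - t) * (1 - σ) * y' j) ≤ M := by
    intro y' ly' hy1' By' hcy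
    have hy0' : ∀ j, 0 ≤ y' j := fun j => (hr0 j).le.trans (ly' j)
    have inner := prod_le_of_atMostOneInterior
      (K := fun j => τ * t + τ * (1 - t) * σ + (1 - τ) * t * s + τ * (1 - t) * (1 - σ) * y' j +
        (1 - τ) * (1 - t) * ((1 - σ) * ((1 - s) * e j + s * g j) + σ * ((1 - s) * f j + s * h j)))
      (P := (1 - τ) * t * (1 - s)) (ℓ := fun j => (1 - σ) * e j + σ * f j) (B := ((1 - σ) * α00 + σ * α10) ^ (n - 1))
      (M := M) (fun j => add_nonneg (add_nonneg hκ (mul_nonneg hP (hy0' j))) (mul_nonneg hQ (hblk j))) hR hc0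
      (fun x' lx' hx1' Bx' hcx => by
        have key := hC n e g f h y' x' he hg hf hh hh1 leg lef lgh lfh ly' hy1' lx' hx1' Be Bg Bf Bh Br0 Br1 Bc0 Bc1 BA By'
          Bx' hcy hcx
        rw [← hM] at key
        refine le_of_eq_of_le (prod_congr rfl fun j _ => by ring) key)
      x lx hx1 Bx
    exact le_of_eq_of_le (prod_congr rfl fun j _ => by ring) inner
  have outer := prod_le_of_atMostOneInterior
    (K := fun j => τ * t + τ * (1 - t) * σ + (1 - τ) * t * s + (1 - τ) * t * (1 - s) * x j +
      (1 - τ) * (1 - t) * ((1 - σ) * ((1 - s) * e j + s * g j) + σ * ((1 - s) * f j + s * h j)))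
    (P := τ * (1 - t) * (1 - σ)) (ℓ := fun j => (1 - s) * e j + s * g j) (B := ((1 - s) * α00 + s * α01) ^ (n - 1))
    (M := M) (fun j => add_nonneg (add_nonneg hκ (mul_nonneg hR ((hc0 j).le.trans (lx j)))) (mul_nonneg hQ (hblk j))) hP hr0
    step y ly hy1 By
  exact le_of_eq_of_le (prod_congr rfl fun j _ => by ring) outer

end LeafLeafZ

end SafeCalc

end Summit.CriticalPhenomena.PercolationContinuityZ3.Theorems.SunflowerPartition
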